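import Literature.MathematicalPhysics.QuantumLattice.LiebFluxPhase
import Literature.MathematicalPhysics.QuantumLattice.LiebFluxPhaseKronecker
import Literature.MathematicalPhysics.QuantumLattice.FermionRelabelling
import Literature.MathematicalPhysics.QuantumLattice.XYOrderGDProofs
import HarnessLib

/-!
# Lieb's decomposition `H = H_L + H_R + H_int` of the Peierls–Hubbard Hamiltonian in Kronecker form

Support file for the proof of Lieb's flux-phase theorem `Lieb1994_fluxPi_torus`
(`LiebFluxPhase.lean`; E. H. Lieb, PRL **73** (1994) 2158). For a finite graph `G` on a linearly
ordered site set `Λ`, a decidable predicate `p` ("left") splits the sites into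
`Λ_L = {x // p x}` (`Lsub p`) and `Λ_R = {x // ¬p x}` (`Rsub p`). Relabelling the orbitals
`Orb Λ = Λ ×ₗ Fin 2` along `orbSplit p : Orb Λ ≃ Orb Λ_L ⊕ₗ Orb Λ_R` (the tree's `relabel`, any
bijection) and splitting the configurations (`JWSplit.splitAlgEquiv`,
`LiebFluxPhaseKronecker.lean`) gives an algebra equivalence `splitHom p` of the Fock-space matrix
algebra with the matrices on `𝒫(Orb Λ_L) × 𝒫(Orb Λ_R)`, under which Lieb's eq. (5) [Lieb1994],

  `H = H_L + H_R + H_int`,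

becomes the EXACT identity (`splitHom_peierlsHubbard`)

  `Φ(H(T)) = H_L(T) ⊗ 1 + 1 ⊗ H_R(T) + crossTerm`,

with `H_L(T) = peierlsHubbard G_L T|_L U`, `H_R(T) = peierlsHubbard G_R T|_R U` the Peierls–Hubbard
Hamiltonians of the induced subgraphs (`SimpleGraph.comap` of the subtype embeddings) and
`crossTerm p G T = -Σ [x ∼ y, x ∈ L, y ∈ R] (T σ x y (c†_x P) ⊗ c_y + T σ y x (P c_x) ⊗ c†_y)` the
hopping THROUGH the cut (`P = (-1)^{N_L}`) — Lieb's `K_int` with the fermionic signs written as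
the left parity (cf. the proof of his Lemma, p. 3). The on-site term `U(n_{x↑} - ½)(n_{x↓} - ½)`
contributes to `H_L` or `H_R` only [Lieb1994, eq. (2)].

## References

* [Lieb1994] E. H. Lieb, Phys. Rev. Lett. 73 (1994) 2158, eqs. (2), (5).
-/

noncomputable section

namespace Literature.MathematicalPhysics.QuantumLattice

open Matrix Finset HubbardWave0 JWSplit
open scoped Kronecker

/-! ### Kronecker bookkeeping (complements to the helpers of `XYOrderGDProofs`) -/

section KroneckerLemmas

variable {m n : Type*}

/-- `(-A) ⊗ B = -(A ⊗ B)`. [folklore] -/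
theorem neg_kronecker (A : Matrix m m ℂ) (B : Matrix n n ℂ) : (-A) ⊗ₖ B = -(A ⊗ₖ B) := by
  ext ⟨i, j⟩ ⟨i', j'⟩
  simp [kroneckerMap_apply]

/-- `A ⊗ (-B) = -(A ⊗ B)`. [folklore] -/
theorem kronecker_neg (A : Matrix m m ℂ) (B : Matrix n n ℂ) : A ⊗ₖ (-B) = -(A ⊗ₖ B) := by
  ext ⟨i, j⟩ ⟨i', j'⟩
  simp [kroneckerMap_apply]

/-- `(if q then A else 0) ⊗ B = if q then A ⊗ B else 0`. [folklore] -/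
theorem ite_kronecker (q : Prop) [Decidable q] (A : Matrix m m ℂ) (B : Matrix n n ℂ) :
    (if q then A else 0) ⊗ₖ B = if q then A ⊗ₖ B else 0 := by
  split_ifs <;> simp

/-- `A ⊗ (if q then B else 0) = if q then A ⊗ B else 0`. [folklore] -/
theorem kronecker_ite (q : Prop) [Decidable q] (A : Matrix m m ℂ) (B : Matrix n n ℂ) :
    A ⊗ₖ (if q then B else 0) = if q then A ⊗ₖ B else 0 := by
  split_ifs <;> simp

end KroneckerLemmas

namespace PeierlsSplit

variable {Λ : Type*} [LinearOrder Λ] [Fintype Λ] (p : Λ → Prop) [DecidablePred p]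

/-- The left sites `Λ_L = {x // p x}`. [cite: Lieb1994, eq. (5)] -/
abbrev Lsub : Type _ := {x : Λ // p x}

/-- The right sites `Λ_R = {x // ¬p x}`. [cite: Lieb1994, eq. (5)] -/
abbrev Rsub : Type _ := {x : Λ // ¬p x}

omit [Fintype Λ] [DecidablePred p] in
/-- Shortcut instance: equality of orbital configurations of a sub-lattice is decidable, decided
through the linear order of the orbitals (the path the generic lemmas of `LiebFluxPhaseKronecker`
instantiate to; the default search exceeds `synthInstance.maxSize` on the product index used below
and would otherwise pick a syntactically different instance). [folklore] -/
instance instDecidableEqFinsetOrbSubtype (q : Λ → Prop) :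
    DecidableEq (Finset (Orb {x : Λ // q x})) :=
  fun a b => @Finset.decidableEq (Orb {x : Λ // q x}) (fun i j => LinearOrder.toDecidableEq i j) a b

/-! ### Splitting the orbitals -/

/-- The orbital bijection `Orb Λ ≃ Orb Λ_L ⊕ₗ Orb Λ_R`, `(x, σ) ↦ inl (x, σ)` or `inr (x, σ)` according
to the side of `x`. [cite: Lieb1994, eq. (5) (left and right algebras)] -/
def orbSplit : Orb Λ ≃ (Orb (Lsub p)) ⊕ₗ (Orb (Rsub p)) where
  toFun i :=
    if h : p (ofLex i).1 then toLex (Sum.inl (orb (⟨(ofLex i).1, h⟩ : Lsub p) (ofLex i).2))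
    else toLex (Sum.inr (orb (⟨(ofLex i).1, h⟩ : Rsub p) (ofLex i).2))
  invFun j := Sum.elim (fun a : Orb (Lsub p) => orb (ofLex a).1.1 (ofLex a).2)
    (fun b : Orb (Rsub p) => orb (ofLex b).1.1 (ofLex b).2) (ofLex j)
  left_inv i := by
    by_cases h : p (ofLex i).1
    · simp only [dif_pos h, ofLex_toLex, Sum.elim_inl]
      rfl
    · simp only [dif_neg h, ofLex_toLex, Sum.elim_inr]
      rfl
  right_inv j := by
    obtain ⟨j, rfl⟩ := (toLex : _ ≃ (Orb (Lsub p)) ⊕ₗ (Orb (Rsub p))).surjective j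
    rcases j with a | b
    · have h : p (ofLex a).1.1 := (ofLex a).1.2
      simp only [ofLex_toLex, Sum.elim_inl, orb, dif_pos h]
      rfl
    · have h : ¬p (ofLex b).1.1 := (ofLex b).1.2
      simp only [ofLex_toLex, Sum.elim_inr, orb, dif_neg h]
      rfl

omit [LinearOrder Λ] [Fintype Λ] in
/-- A left orbital goes to the left summand. [folklore] -/
theorem orbSplit_orb_of_pos (x : Λ) (σ : Fin 2) (h : p x) :
    orbSplit p (orb x σ) = toLex (Sum.inl (orb (⟨x, h⟩ : Lsub p) σ)) := by
  simp [orbSplit, orb, dif_pos h]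

omit [LinearOrder Λ] [Fintype Λ] in
/-- A right orbital goes to the right summand. [folklore] -/
theorem orbSplit_orb_of_neg (y : Λ) (σ : Fin 2) (h : ¬p y) :
    orbSplit p (orb y σ) = toLex (Sum.inr (orb (⟨y, h⟩ : Rsub p) σ)) := by
  simp [orbSplit, orb, dif_neg h]

/-! ### The splitting homomorphism and the images of the Jordan–Wigner matrices -/

/-- **The splitting isomorphism** `Φ = split ∘ relabel`: the Fock-space matrix algebra of `Λ` onto
the matrices on `𝒫(Orb Λ_L) × 𝒫(Orb Λ_R)`. [cite: Lieb1994, eq. (5)] -/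
def splitHom : Matrix (Finset (Orb Λ)) (Finset (Orb Λ)) ℂ ≃ₐ[ℂ]
    Matrix (Finset (Orb (Lsub p)) × Finset (Orb (Rsub p)))
      (Finset (Orb (Lsub p)) × Finset (Orb (Rsub p))) ℂ :=
  (relabel (orbSplit p)).trans splitAlgEquiv

/-- Unfolding lemma. [folklore] -/
theorem splitHom_apply (a : Matrix (Finset (Orb Λ)) (Finset (Orb Λ)) ℂ) :
    splitHom p a = splitAlgEquiv (relabel (orbSplit p) a) := rfl

/-- `Φ(c†_{xσ}) = c†_{xσ} ⊗ 1` for a left site. [cite: Lieb1994, proof of the Lemma] -/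
theorem splitHom_creation_of_pos (x : Λ) (σ : Fin 2) (h : p x) :
    splitHom p (creation (orb x σ)) =
      creation (orb (⟨x, h⟩ : Lsub p) σ) ⊗ₖ (1 : Matrix (Finset (Orb (Rsub p))) _ ℂ) := by
  rw [splitHom_apply, relabel_creation, orbSplit_orb_of_pos p x σ h, splitAlgEquiv_apply,
    reindex_creation_inl]

/-- `Φ(c_{xσ}) = c_{xσ} ⊗ 1` for a left site. [cite: Lieb1994, proof of the Lemma] -/
theorem splitHom_annihilation_of_pos (x : Λ) (σ : Fin 2) (h : p x) :
    splitHom p (annihilation (orb x σ)) =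
      annihilation (orb (⟨x, h⟩ : Lsub p) σ) ⊗ₖ (1 : Matrix (Finset (Orb (Rsub p))) _ ℂ) := by
  rw [splitHom_apply, relabel_annihilation, orbSplit_orb_of_pos p x σ h, splitAlgEquiv_apply,
    reindex_annihilation_inl]

/-- `Φ(c†_{yσ}) = P ⊗ c†_{yσ}` for a right site. [cite: Lieb1994, proof of the Lemma] -/
theorem splitHom_creation_of_neg (y : Λ) (σ : Fin 2) (h : ¬p y) :
    splitHom p (creation (orb y σ)) =
      (parityOp : Matrix (Finset (Orb (Lsub p))) _ ℂ) ⊗ₖ creation (orb (⟨y, h⟩ : Rsub p) σ) := by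
  rw [splitHom_apply, relabel_creation, orbSplit_orb_of_neg p y σ h, splitAlgEquiv_apply,
    reindex_creation_inr]

/-- `Φ(c_{yσ}) = P ⊗ c_{yσ}` for a right site. [cite: Lieb1994, proof of the Lemma] -/
theorem splitHom_annihilation_of_neg (y : Λ) (σ : Fin 2) (h : ¬p y) :
    splitHom p (annihilation (orb y σ)) =
      (parityOp : Matrix (Finset (Orb (Lsub p))) _ ℂ) ⊗ₖ annihilation (orb (⟨y, h⟩ : Rsub p) σ) := by
  rw [splitHom_apply, relabel_annihilation, orbSplit_orb_of_neg p y σ h, splitAlgEquiv_apply,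
    reindex_annihilation_inr]

/-- Left–left bilinear. [cite: Lieb1994, eq. (5) (`H_L`)] -/
theorem splitHom_hop_LL (x y : Λ) (σ : Fin 2) (hx : p x) (hy : p y) :
    splitHom p (creation (orb x σ) * annihilation (orb y σ)) =
      (creation (orb (⟨x, hx⟩ : Lsub p) σ) * annihilation (orb (⟨y, hy⟩ : Lsub p) σ)) ⊗ₖ
        (1 : Matrix (Finset (Orb (Rsub p))) _ ℂ) := by
  rw [map_mul, splitHom_creation_of_pos p x σ hx, splitHom_annihilation_of_pos p y σ hy,
    ← mul_kronecker_mul, Matrix.mul_one]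

/-- Right–right bilinear. [cite: Lieb1994, eq. (5) (`H_R`)] -/
theorem splitHom_hop_RR (x y : Λ) (σ : Fin 2) (hx : ¬p x) (hy : ¬p y) :
    splitHom p (creation (orb x σ) * annihilation (orb y σ)) =
      (1 : Matrix (Finset (Orb (Lsub p))) _ ℂ) ⊗ₖ
        (creation (orb (⟨x, hx⟩ : Rsub p) σ) * annihilation (orb (⟨y, hy⟩ : Rsub p) σ)) := by
  rw [map_mul, splitHom_creation_of_neg p x σ hx, splitHom_annihilation_of_neg p y σ hy,
    ← mul_kronecker_mul, parityOp_mul_parityOp]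

/-- Left–right hopping: `Φ(c†_x c_y) = (c†_x P) ⊗ c_y`. [cite: Lieb1994, proof of the Lemma, case (ii)] -/
theorem splitHom_hop_LR (x y : Λ) (σ : Fin 2) (hx : p x) (hy : ¬p y) :
    splitHom p (creation (orb x σ) * annihilation (orb y σ)) =
      (creation (orb (⟨x, hx⟩ : Lsub p) σ) * parityOp : Matrix (Finset (Orb (Lsub p))) _ ℂ) ⊗ₖ
        annihilation (orb (⟨y, hy⟩ : Rsub p) σ) := by
  rw [map_mul, splitHom_creation_of_pos p x σ hx, splitHom_annihilation_of_neg p y σ hy,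
    ← mul_kronecker_mul, Matrix.one_mul]

/-- Right–left hopping: `Φ(c†_y c_x) = (P c_x) ⊗ c†_y`. [cite: Lieb1994, proof of the Lemma, case (iii)] -/
theorem splitHom_hop_RL (x y : Λ) (σ : Fin 2) (hx : p x) (hy : ¬p y) :
    splitHom p (creation (orb y σ) * annihilation (orb x σ)) =
      (parityOp * annihilation (orb (⟨x, hx⟩ : Lsub p) σ) : Matrix (Finset (Orb (Lsub p))) _ ℂ) ⊗ₖ
        creation (orb (⟨y, hy⟩ : Rsub p) σ) := by
  rw [map_mul, splitHom_creation_of_neg p y σ hy, splitHom_annihilation_of_pos p x σ hx,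
    ← mul_kronecker_mul, Matrix.mul_one]

/-- `Φ(n_{xσ}) = n_{xσ} ⊗ 1` for a left site. [folklore] -/
theorem splitHom_numberOp_of_pos (x : Λ) (σ : Fin 2) (h : p x) :
    splitHom p (numberOp x σ) =
      numberOp (⟨x, h⟩ : Lsub p) σ ⊗ₖ (1 : Matrix (Finset (Orb (Rsub p))) _ ℂ) :=
  splitHom_hop_LL p x x σ h h

/-- `Φ(n_{yσ}) = 1 ⊗ n_{yσ}` for a right site. [folklore] -/
theorem splitHom_numberOp_of_neg (y : Λ) (σ : Fin 2) (h : ¬p y) :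
    splitHom p (numberOp y σ) =
      (1 : Matrix (Finset (Orb (Lsub p))) _ ℂ) ⊗ₖ numberOp (⟨y, h⟩ : Rsub p) σ :=
  splitHom_hop_RR p y y σ h h

/-- `Φ(1) = 1 ⊗ 1`. [folklore] -/
theorem splitHom_one :
    splitHom p 1 = (1 : Matrix (Finset (Orb (Lsub p))) _ ℂ) ⊗ₖ
      (1 : Matrix (Finset (Orb (Rsub p))) _ ℂ) := by
  rw [map_one, one_kronecker_one]

/-- The on-site interaction of a left site: `Φ((n_{x↑}-½)(n_{x↓}-½)) = ((n_{x↑}-½)(n_{x↓}-½)) ⊗ 1`.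
[cite: Lieb1994, eq. (2)] -/
theorem splitHom_interaction_of_pos (x : Λ) (h : p x) :
    splitHom p ((numberOp x 0 - (1 / 2 : ℂ) • 1) * (numberOp x 1 - (1 / 2 : ℂ) • 1)) =
      ((numberOp (⟨x, h⟩ : Lsub p) 0 - (1 / 2 : ℂ) • 1) * (numberOp (⟨x, h⟩ : Lsub p) 1 - (1 / 2 : ℂ) • 1)) ⊗ₖ
        (1 : Matrix (Finset (Orb (Rsub p))) _ ℂ) := by
  rw [map_mul, map_sub, map_sub, map_smul, splitHom_numberOp_of_pos p x 0 h,
    splitHom_numberOp_of_pos p x 1 h, splitHom_one, ← smul_kronecker, ← sub_kronecker,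
    ← sub_kronecker, ← mul_kronecker_mul, Matrix.mul_one]

/-- The on-site interaction of a right site: `Φ((n_{y↑}-½)(n_{y↓}-½)) = 1 ⊗ ((n_{y↑}-½)(n_{y↓}-½))`.
[cite: Lieb1994, eq. (2)] -/
theorem splitHom_interaction_of_neg (y : Λ) (h : ¬p y) :
    splitHom p ((numberOp y 0 - (1 / 2 : ℂ) • 1) * (numberOp y 1 - (1 / 2 : ℂ) • 1)) =
      (1 : Matrix (Finset (Orb (Lsub p))) _ ℂ) ⊗ₖ
        ((numberOp (⟨y, h⟩ : Rsub p) 0 - (1 / 2 : ℂ) • 1) * (numberOp (⟨y, h⟩ : Rsub p) 1 - (1 / 2 : ℂ) • 1)) := by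
  rw [map_mul, map_sub, map_sub, map_smul, splitHom_numberOp_of_neg p y 0 h,
    splitHom_numberOp_of_neg p y 1 h, splitHom_one, ← kronecker_smul, ← kronecker_sub,
    ← kronecker_sub, ← mul_kronecker_mul, Matrix.mul_one]

/-! ### The three pieces -/

variable (G : SimpleGraph Λ) [DecidableRel G.Adj]

/-- The induced graph on the left sites. [cite: Lieb1994, eq. (5)] -/
abbrev leftGraph : SimpleGraph (Lsub p) := G.comap (Function.Embedding.subtype p)

/-- The induced graph on the right sites. [cite: Lieb1994, eq. (5)] -/
abbrev rightGraph : SimpleGraph (Rsub p) := G.comap (Function.Embedding.subtype (¬p ·))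

/-- **`H_L`**: the Peierls–Hubbard Hamiltonian of the left half (induced graph, restricted
amplitudes, the same `U`). [cite: Lieb1994, eq. (5)] -/
abbrev leftHamiltonian (T : Fin 2 → Λ → Λ → ℂ) (U : ℝ) :
    Matrix (Finset (Orb (Lsub p))) (Finset (Orb (Lsub p))) ℂ :=
  peierlsHubbard (leftGraph p G) (fun σ a b => T σ a.1 b.1) U

/-- **`H_R`**: the Peierls–Hubbard Hamiltonian of the right half. [cite: Lieb1994, eq. (5)] -/
abbrev rightHamiltonian (T : Fin 2 → Λ → Λ → ℂ) (U : ℝ) :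
    Matrix (Finset (Orb (Rsub p))) (Finset (Orb (Rsub p))) ℂ :=
  peierlsHubbard (rightGraph p G) (fun σ a b => T σ a.1 b.1) U

/-- The left–right hopping letter `(c†_{aσ} P) ⊗ c_{bσ}`. [cite: Lieb1994, proof of the Lemma, case (ii)] -/
abbrev hopLR (a : Lsub p) (b : Rsub p) (σ : Fin 2) :
    Matrix (Finset (Orb (Lsub p)) × Finset (Orb (Rsub p)))
      (Finset (Orb (Lsub p)) × Finset (Orb (Rsub p))) ℂ :=
  (creation (orb a σ) * parityOp : Matrix (Finset (Orb (Lsub p))) _ ℂ) ⊗ₖ annihilation (orb b σ)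

/-- The right–left hopping letter `(P c_{aσ}) ⊗ c†_{bσ}`. [cite: Lieb1994, proof of the Lemma, case (iii)] -/
abbrev hopRL (a : Lsub p) (b : Rsub p) (σ : Fin 2) :
    Matrix (Finset (Orb (Lsub p)) × Finset (Orb (Rsub p)))
      (Finset (Orb (Lsub p)) × Finset (Orb (Rsub p))) ℂ :=
  (parityOp * annihilation (orb a σ) : Matrix (Finset (Orb (Lsub p))) _ ℂ) ⊗ₖ creation (orb b σ)

/-- **`H_int` in Kronecker form**: the hopping through the cut,
`-Σ_{x ∈ L, y ∈ R, x ∼ y} Σ_σ (T σ x y (c†_{xσ} P) ⊗ c_{yσ} + T σ y x (P c_{xσ}) ⊗ c†_{yσ})`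
(`P = (-1)^{N_L}`). [cite: Lieb1994, eq. (5) and proof of the Lemma, cases (ii)–(iii)] -/
def crossTerm (T : Fin 2 → Λ → Λ → ℂ) :
    Matrix (Finset (Orb (Lsub p)) × Finset (Orb (Rsub p)))
      (Finset (Orb (Lsub p)) × Finset (Orb (Rsub p))) ℂ :=
  -(∑ a : Lsub p, ∑ b : Rsub p, ∑ σ : Fin 2,
      if G.Adj a.1 b.1 then T σ a.1 b.1 • hopLR p a b σ else 0) -
    ∑ b : Rsub p, ∑ a : Lsub p, ∑ σ : Fin 2,
      if G.Adj b.1 a.1 then T σ b.1 a.1 • hopRL p a b σ else 0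

omit [LinearOrder Λ] in
/-- Splitting a sum over the sites into left and right sites. [folklore] -/
theorem sum_eq_sum_add_sum {M : Type*} [AddCommMonoid M] (f : Λ → M) :
    ∑ x, f x = ∑ a : Lsub p, f a.1 + ∑ b : Rsub p, f b.1 :=
  (Fintype.sum_subtype_add_sum_subtype p f).symm

/-- **Lieb's decomposition `H = H_L + H_R + H_int` in Kronecker form**:
`Φ(H(T)) = H_L(T) ⊗ 1 + 1 ⊗ H_R(T) + crossTerm`. [cite: Lieb1994, eq. (5)] -/
theorem splitHom_peierlsHubbard (T : Fin 2 → Λ → Λ → ℂ) (U : ℝ) :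
    splitHom p (peierlsHubbard G T U) =
      leftHamiltonian p G T U ⊗ₖ (1 : Matrix (Finset (Orb (Rsub p))) _ ℂ) +
        (1 : Matrix (Finset (Orb (Lsub p))) _ ℂ) ⊗ₖ rightHamiltonian p G T U +
        crossTerm p G T := by
  -- the hopping term of `x, y`, as a function to be split
  set F : Λ → Λ → Matrix (Finset (Orb Λ)) (Finset (Orb Λ)) ℂ := fun x y =>
    ∑ σ : Fin 2, if G.Adj x y then T σ x y • (creation (orb x σ) * annihilation (orb y σ)) else 0
    with hF
  have hhop : ∀ (x y : Λ) (σ : Fin 2),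
      splitHom p (if G.Adj x y then T σ x y • (creation (orb x σ) * annihilation (orb y σ)) else 0) =
        if G.Adj x y then T σ x y • splitHom p (creation (orb x σ) * annihilation (orb y σ)) else 0 := by
    intro x y σ
    split_ifs
    · rw [map_smul]
    · rw [map_zero]
  -- LL block
  have hLL : ∑ a : Lsub p, ∑ a' : Lsub p, splitHom p (F a.1 a'.1) =
      (∑ a : Lsub p, ∑ a' : Lsub p, ∑ σ : Fin 2,
        if G.Adj a.1 a'.1 then T σ a.1 a'.1 • (creation (orb a σ) * annihilation (orb a' σ)) else 0) ⊗ₖ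
        (1 : Matrix (Finset (Orb (Rsub p))) _ ℂ) := by
    rw [sum_kronecker]
    refine Finset.sum_congr rfl fun a _ => ?_
    rw [sum_kronecker]
    refine Finset.sum_congr rfl fun a' _ => ?_
    rw [hF, map_sum, sum_kronecker]
    refine Finset.sum_congr rfl fun σ _ => ?_
    rw [hhop, ite_kronecker, smul_kronecker, splitHom_hop_LL p a.1 a'.1 σ a.2 a'.2]
  -- RR block
  have hRR : ∑ b : Rsub p, ∑ b' : Rsub p, splitHom p (F b.1 b'.1) =
      (1 : Matrix (Finset (Orb (Lsub p))) _ ℂ) ⊗ₖ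
        (∑ b : Rsub p, ∑ b' : Rsub p, ∑ σ : Fin 2,
          if G.Adj b.1 b'.1 then T σ b.1 b'.1 • (creation (orb b σ) * annihilation (orb b' σ)) else 0) := by
    rw [kronecker_sum]
    refine Finset.sum_congr rfl fun b _ => ?_
    rw [kronecker_sum]
    refine Finset.sum_congr rfl fun b' _ => ?_
    rw [hF, map_sum, kronecker_sum]
    refine Finset.sum_congr rfl fun σ _ => ?_
    rw [hhop, kronecker_ite, kronecker_smul, splitHom_hop_RR p b.1 b'.1 σ b.2 b'.2]
  -- LR block
  have hLR : ∑ a : Lsub p, ∑ b : Rsub p, splitHom p (F a.1 b.1) =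
      ∑ a : Lsub p, ∑ b : Rsub p, ∑ σ : Fin 2,
        if G.Adj a.1 b.1 then T σ a.1 b.1 • hopLR p a b σ else 0 := by
    refine Finset.sum_congr rfl fun a _ => Finset.sum_congr rfl fun b _ => ?_
    rw [hF, map_sum]
    refine Finset.sum_congr rfl fun σ _ => ?_
    rw [hhop, splitHom_hop_LR p a.1 b.1 σ a.2 b.2]
  -- RL block
  have hRL : ∑ b : Rsub p, ∑ a : Lsub p, splitHom p (F b.1 a.1) =
      ∑ b : Rsub p, ∑ a : Lsub p, ∑ σ : Fin 2,
        if G.Adj b.1 a.1 then T σ b.1 a.1 • hopRL p a b σ else 0 := by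
    refine Finset.sum_congr rfl fun b _ => Finset.sum_congr rfl fun a _ => ?_
    rw [hF, map_sum]
    refine Finset.sum_congr rfl fun σ _ => ?_
    rw [hhop, splitHom_hop_RL p a.1 b.1 σ a.2 b.2]
  -- the hopping part, split into four blocks
  have hT : splitHom p (∑ x : Λ, ∑ y : Λ, ∑ σ : Fin 2,
      if G.Adj x y then T σ x y • (creation (orb x σ) * annihilation (orb y σ)) else 0) =
      (∑ a : Lsub p, ∑ a' : Lsub p, ∑ σ : Fin 2,
        if G.Adj a.1 a'.1 then T σ a.1 a'.1 • (creation (orb a σ) * annihilation (orb a' σ)) else 0) ⊗ₖ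
          (1 : Matrix (Finset (Orb (Rsub p))) _ ℂ) +
      (1 : Matrix (Finset (Orb (Lsub p))) _ ℂ) ⊗ₖ
        (∑ b : Rsub p, ∑ b' : Rsub p, ∑ σ : Fin 2,
          if G.Adj b.1 b'.1 then T σ b.1 b'.1 • (creation (orb b σ) * annihilation (orb b' σ)) else 0) +
      ((∑ a : Lsub p, ∑ b : Rsub p, ∑ σ : Fin 2,
          if G.Adj a.1 b.1 then T σ a.1 b.1 • hopLR p a b σ else 0) +
        ∑ b : Rsub p, ∑ a : Lsub p, ∑ σ : Fin 2,
          if G.Adj b.1 a.1 then T σ b.1 a.1 • hopRL p a b σ else 0) := by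
    have h1 : (∑ x : Λ, ∑ y : Λ, ∑ σ : Fin 2,
        if G.Adj x y then T σ x y • (creation (orb x σ) * annihilation (orb y σ)) else 0) =
        ∑ x : Λ, ∑ y : Λ, F x y := rfl
    rw [h1, map_sum, sum_eq_sum_add_sum p]
    simp only [map_sum]
    have h2 : ∀ x : Λ, ∑ y : Λ, splitHom p (F x y) =
        ∑ a' : Lsub p, splitHom p (F x a'.1) + ∑ b' : Rsub p, splitHom p (F x b'.1) :=
      fun x => sum_eq_sum_add_sum p _
    simp only [h2, Finset.sum_add_distrib]
    rw [hLL, hRR, hLR, hRL]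
    abel
  -- the interaction part
  have hW : splitHom p (∑ x : Λ, (numberOp x 0 - (1 / 2 : ℂ) • 1) * (numberOp x 1 - (1 / 2 : ℂ) • 1)) =
      (∑ a : Lsub p, (numberOp a 0 - (1 / 2 : ℂ) • 1) * (numberOp a 1 - (1 / 2 : ℂ) • 1)) ⊗ₖ
          (1 : Matrix (Finset (Orb (Rsub p))) _ ℂ) +
        (1 : Matrix (Finset (Orb (Lsub p))) _ ℂ) ⊗ₖ
          ∑ b : Rsub p, (numberOp b 0 - (1 / 2 : ℂ) • 1) * (numberOp b 1 - (1 / 2 : ℂ) • 1) := by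
    rw [map_sum, sum_eq_sum_add_sum p, sum_kronecker, kronecker_sum]
    congr 1
    · exact Finset.sum_congr rfl fun a _ => splitHom_interaction_of_pos p a.1 a.2
    · exact Finset.sum_congr rfl fun b _ => splitHom_interaction_of_neg p b.1 b.2
  -- assemble
  dsimp only [leftHamiltonian, rightHamiltonian]
  rw [peierlsHubbard_def, map_add, map_neg, map_smul, hT, hW, crossTerm, peierlsHubbard_def,
    peierlsHubbard_def, add_kronecker, kronecker_add, neg_kronecker, kronecker_neg, smul_kronecker,
    kronecker_smul, smul_add]
  simp only [SimpleGraph.comap_adj, Function.Embedding.coe_subtype]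
  abel

end PeierlsSplit

end Literature.MathematicalPhysics.QuantumLattice

end
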